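import Summits.PneNP.PneNP.Theorems.ConvexRankGatesCliqueExtLowerBoundWidthThresholdNarrow
import Summits.PneNP.PneNP.Theorems.ConvexRankGatesCliqueExtLowerBoundStubConvLowDimStructure
import Summits.PneNP.PneNP.Theorems.ConvexRankGatesCliqueExtLowerBoundStubThresholdIntegerWeights
import Summits.PneNP.PneNP.Theorems.ConvexRankGatesCliqueExtLowerBoundStubIntegerThresholdCircuit
import Summits.PneNP.PneNP.Theorems.ConvexRankGatesCliqueExtLowerBoundStubAndThresholdAssembly
import Summits.PneNP.PneNP.Theorems.ConvexRankGatesCliqueExtLowerBoundSandwichEffectiveWidth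

/-!
# Unconditional lower bounds for CLIQUE over monotone circuits with REAL THRESHOLD gates of any
fan-in, low-dimensional CONV gates and the settled algebraic classes (line
`width-threshold-certificate-sparsity`, crux `CliqueExtLowerBound`, stmt-PneNP-10682, route
PneNP/ConvexRankGates)

**Theorem (`realThreshold_lowerBound`).** For every `c`, eventually in `m`, no circuit with at most
`m^c` gates over the basis `{∧₂, ∨₂} ∪ THR_ℝ ∪ PERM_{T(m)} ∪ GRANK_{T(m)}`, `T(m) = ⌊m^{1/16}⌋₊`,
computes `CLIQUE(m, ⌈m^{1/4}⌉₊)`, where `THR_ℝ` is the class of ALL non-negatively real-weighted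
threshold gates `[h ≤ ∑ⱼ βⱼ vⱼ]` (`β ≥ 0`, `h ∈ ℝ`) of UNBOUNDED fan-in — it contains `∧ₖ`, `∨ₖ`,
`MAJₖ`, `Tₜᵏ` for every `k`. In print such a bound is only available through monotone REAL circuits
(Pudlák 1997; Haken–Cook 1999); here it is the composition of the line's event-currency engine with
the four landed wave-1 stubs.

**Theorem (`lowDimConv_lowerBound`).** The same for `{∧₂, ∨₂} ∪ CONV^{≤1}_{m^c} ∪ PERM_{T(m)} ∪
GRANK_{T(m)}`, `CONV^{≤1}_{m^c}` the CONV (SDP-feasibility) gates of width `p + q ≤ m^c` whose psd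
variable has dimension `q ≤ 1` (ANDs of `≤ (m^c+1)²` real thresholds).

**Theorem (`kitchenSink_lowerBound`).** The same for the union of the gate classes settled so far in
built modules: `THR_ℝ`, `CONV^{≤1}_{m^c}`, narrow PERM/GRANK, PERM gates (any number of points)
generating a group of order `< 2^{L+1}` and GRANK gates (any dimension, any field) with threshold
`θ ≤ L`, `L = ⌊m^{1/16}⌋₊ (log₂ ⌊m^{1/16}⌋₊ + 1)` (`SandwichEffectiveWidth`). Deliberately NOT here
(their modules `…PermPartial`, `…GRankPartial2` had no hub olean when this file landed; same one-line
wrappers): cyclic PERM gates on `≤ m^c` points and GRANK gates with moving part of generic rank `≤ L`.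

**Proof.** The pattern of `narrowLowerBound` (…WidthThresholdNarrow.lean), made generic in the gate
class (`lowerBound_of_statement`, `union_statement`): per class a sandwichability statement
`∀ c, ∃ r₀ s₀, ∀ r s ≥ …, ∀ᶠ m, ∀ φ ∈ class, Sandwichable r s (m^{c+3}) (posFam m) (negFam m) (eps m c) φ`;
`∧₂/∨₂` replace themselves (`replaceable_of_mem_monotoneBasis` + `inline_statement 0 c`), narrow
PERM/GRANK by `narrowAlgebraic_statement`, real thresholds / low-dimensional CONV data by the landed
`AndThreshold.stub_andThresholdAssembly` fed with `IntegerWeights.stub_thresholdIntegerWeights`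
(Muroga) and `ThresholdCircuit.stub_integerThresholdCircuit`, after
`ConvLowDim.stub_convLowDimStructure` (a single threshold is the case `K = 1`); take `r, s` as
maxima of the thresholds, intersect the eventualities with `referee_statement s` and run `core`.

References: S. Jukna, *Boolean Function Complexity* (2012), §9.3–9.4 [Jukna2012]; S. Muroga,
*Threshold logic and its applications* (1971) [Muroga1971]; P. Pudlák, Lower bounds for resolution
and cutting plane proofs and monotone computations, J. Symb. Logic 62 (1997); A. Haken, S. A. Cook,
An exponential lower bound for the size of monotone real circuits, JCSS 58 (1999).
-/

set_option linter.dupNamespace false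

open Literature.Computability.Complexity Filter Finset
open Summit.PneNP.PneNP.Theorems.CliqueExtLowerBound.WidthThreshold

noncomputable section

namespace Summit.PneNP.PneNP.Theorems.CliqueExtLowerBound.WidthThreshold.ThresholdLowerBound

/-! ## §1 The composition, generic in the gate class -/

/-- Two sandwichable gate classes have a sandwichable union (thresholds: the maxima). [folklore] -/
theorem union_statement {P Q : ℕ → ℕ → GateFn → Prop}
    (hP : ∀ c : ℕ, ∃ r₀ s₀ : ℕ, 2 ≤ r₀ ∧ 2 ≤ s₀ ∧ ∀ r s : ℕ, r₀ ≤ r → s₀ ≤ s →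
      ∀ᶠ m : ℕ in atTop, ∀ φ : GateFn, P c m φ →
        Sandwichable r s (m ^ (c + 3)) (posFam m) (negFam m) (eps m c) φ)
    (hQ : ∀ c : ℕ, ∃ r₀ s₀ : ℕ, 2 ≤ r₀ ∧ 2 ≤ s₀ ∧ ∀ r s : ℕ, r₀ ≤ r → s₀ ≤ s →
      ∀ᶠ m : ℕ in atTop, ∀ φ : GateFn, Q c m φ →
        Sandwichable r s (m ^ (c + 3)) (posFam m) (negFam m) (eps m c) φ) :
    ∀ c : ℕ, ∃ r₀ s₀ : ℕ, 2 ≤ r₀ ∧ 2 ≤ s₀ ∧ ∀ r s : ℕ, r₀ ≤ r → s₀ ≤ s →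
      ∀ᶠ m : ℕ in atTop, ∀ φ : GateFn, (P c m φ ∨ Q c m φ) →
        Sandwichable r s (m ^ (c + 3)) (posFam m) (negFam m) (eps m c) φ := by
  intro c
  obtain ⟨r₁, s₁, hr₁, hs₁, h₁⟩ := hP c
  obtain ⟨r₂, s₂, -, -, h₂⟩ := hQ c
  refine ⟨max r₁ r₂, max s₁ s₂, le_trans hr₁ (le_max_left _ _), le_trans hs₁ (le_max_left _ _),
    fun r s hr hs => ?_⟩
  filter_upwards [h₁ r s ((le_max_left _ _).trans hr) ((le_max_left _ _).trans hs),
    h₂ r s ((le_max_right _ _).trans hr) ((le_max_right _ _).trans hs)] with m hm₁ hm₂ φ hφ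
  exact hφ.elim (hm₁ φ) (hm₂ φ)

/-- THE COMPOSITION for a monotone gate class `P` sandwichable on the referee pair: for every `c`,
eventually in `m`, no circuit with `≤ m^c` gates over `{∧₂, ∨₂} ∪ P` computes `CLIQUE(m, ⌈m^{1/4}⌉₊)`
— `r, s` are the maxima of the thresholds of `inline_statement 0 c` (`∧₂, ∨₂` replace themselves)
and of the class; intersect with `referee_statement s` and run `core`. [cite: Jukna2012, Thm. 9.17] -/
theorem lowerBound_of_statement {P : ℕ → ℕ → GateFn → Prop}
    (hP : ∀ c : ℕ, ∃ r₀ s₀ : ℕ, 2 ≤ r₀ ∧ 2 ≤ s₀ ∧ ∀ r s : ℕ, r₀ ≤ r → s₀ ≤ s →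
      ∀ᶠ m : ℕ in atTop, ∀ φ : GateFn, P c m φ →
        Sandwichable r s (m ^ (c + 3)) (posFam m) (negFam m) (eps m c) φ)
    (hmono : ∀ (c m : ℕ) (φ : GateFn), P c m φ → Monotone φ.2) (c : ℕ) :
    ∀ᶠ m : ℕ in atTop, ∀ C : Circuit (EV m), C.IsOver (monotoneBasis ∪ {g | P c m g}) →
      C.size ≤ m ^ c → ¬ C.Computes (cliqueFn m (kk m)) := by
  obtain ⟨r₁, s₁, hr₁, hs₁, hI₁⟩ := inline_statement 0 c
  obtain ⟨r₂, s₂, -, -, hS⟩ := hP c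
  have hr2 : 2 ≤ max r₁ r₂ := le_trans hr₁ (le_max_left _ _)
  have hs2 : 2 ≤ max s₁ s₂ := le_trans hs₁ (le_max_left _ _)
  filter_upwards [hI₁ (max r₁ r₂) (max s₁ s₂) (le_max_left _ _) (le_max_left _ _),
    hS (max r₁ r₂) (max s₁ s₂) (le_max_right _ _) (le_max_right _ _),
    referee_statement (max s₁ s₂), eventually_ge_atTop 3] with m h₁ h₂ h₆ hm C hC hsize
  have hε0 : 0 ≤ eps m c := by unfold eps; positivity
  have htwo : eps m c + eps m c = 2 * eps m c := by ring
  refine core hr2 hs2 hm h₆.1 h₆.2 (B := monotoneBasis ∪ {g | P c m g}) ?_ ?_ C hC hsize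
  · rintro φ (hφ | hφ)
    · rcases hφ with rfl | rfl
      · exact GateFn.and_monotone 2
      · exact GateFn.or_monotone 2
    · exact hmono c m φ hφ
  · rintro φ (hφ | hφ)
    · rw [pow_zero] at h₁
      exact htwo ▸ sandwichable_of_replaceable (replaceable_of_mem_monotoneBasis le_rfl hε0 hφ) h₁
    · exact (h₂ φ hφ).of_le (by linarith)

/-! ## §2 The settled gate classes, read in the line's vocabulary -/

/-- ANDs of `≤ (m^c+1)²` non-negatively weighted real thresholds are sandwichable (the landed
`stub_andThresholdAssembly` applied to the landed `stub_thresholdIntegerWeights` and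
`stub_integerThresholdCircuit`, by definitional unfolding). [cite: Jukna2012, Thm. 9.17] -/
theorem andThreshold_statement : ∀ c : ℕ, ∃ r₀ s₀ : ℕ, 2 ≤ r₀ ∧ 2 ≤ s₀ ∧ ∀ r s : ℕ,
    r₀ ≤ r → s₀ ≤ s → ∀ᶠ m : ℕ in atTop, ∀ φ : GateFn,
      (∃ (K : ℕ) (β : Fin K → Fin φ.1 → ℝ) (h : Fin K → ℝ), K ≤ (m ^ c + 1) ^ 2 ∧
        (∀ l j, 0 ≤ β l j) ∧ ∀ v : Fin φ.1 → Bool,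
          φ.2 v = true ↔ ∀ l, h l ≤ ∑ j, β l j * (if v j then (1 : ℝ) else 0)) →
      Sandwichable r s (m ^ (c + 3)) (posFam m) (negFam m) (eps m c) φ :=
  AndThreshold.stub_andThresholdAssembly IntegerWeights.stub_thresholdIntegerWeights
    ThresholdCircuit.stub_integerThresholdCircuit

/-- A single non-negatively weighted real threshold gate is an AND of `K = 1 ≤ (m^c+1)²` such
thresholds. [folklore] -/
theorem threshold_asAnd {m c : ℕ} (φ : GateFn)
    (hφ : ∃ (β : Fin φ.1 → ℝ) (h : ℝ), (∀ j, 0 ≤ β j) ∧ ∀ v : Fin φ.1 → Bool,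
      φ.2 v = true ↔ h ≤ ∑ j, β j * (if v j then (1 : ℝ) else 0)) :
    ∃ (K : ℕ) (β : Fin K → Fin φ.1 → ℝ) (h : Fin K → ℝ), K ≤ (m ^ c + 1) ^ 2 ∧
      (∀ l j, 0 ≤ β l j) ∧ ∀ v : Fin φ.1 → Bool,
        φ.2 v = true ↔ ∀ l, h l ≤ ∑ j, β l j * (if v j then (1 : ℝ) else 0) := by
  obtain ⟨β, h, hβ, hφ⟩ := hφ
  refine ⟨1, fun _ => β, fun _ => h, Nat.one_le_pow _ _ (Nat.succ_pos _), fun _ j => hβ j,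
    fun v => ?_⟩
  rw [hφ v]
  exact ⟨fun hv _ => hv, fun hv => hv 0⟩

/-- A non-negatively weighted real threshold gate is monotone (`v ≤ w ⇒ ∑ βⱼ[vⱼ] ≤ ∑ βⱼ[wⱼ]`).
[folklore] -/
theorem threshold_monotone (φ : GateFn)
    (hφ : ∃ (β : Fin φ.1 → ℝ) (h : ℝ), (∀ j, 0 ≤ β j) ∧ ∀ v : Fin φ.1 → Bool,
      φ.2 v = true ↔ h ≤ ∑ j, β j * (if v j then (1 : ℝ) else 0)) :
    Monotone φ.2 := by
  obtain ⟨β, h, hβ, hg⟩ := hφ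
  refine monotone_of_forall_iff hg fun v w hvw hv => hv.trans ?_
  exact Finset.sum_le_sum fun j _ =>
    mul_le_mul_of_nonneg_left (indicator_le_indicator hvw j) (hβ j)

/-- REAL THRESHOLDS are sandwichable: the case `K = 1` of `andThreshold_statement`. [folklore] -/
theorem threshold_statement : ∀ c : ℕ, ∃ r₀ s₀ : ℕ, 2 ≤ r₀ ∧ 2 ≤ s₀ ∧ ∀ r s : ℕ,
    r₀ ≤ r → s₀ ≤ s → ∀ᶠ m : ℕ in atTop, ∀ φ : GateFn,
      (∃ (β : Fin φ.1 → ℝ) (h : ℝ), (∀ j, 0 ≤ β j) ∧ ∀ v : Fin φ.1 → Bool,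
        φ.2 v = true ↔ h ≤ ∑ j, β j * (if v j then (1 : ℝ) else 0)) →
      Sandwichable r s (m ^ (c + 3)) (posFam m) (negFam m) (eps m c) φ := by
  intro c
  obtain ⟨r₀, s₀, hr₀, hs₀, hT⟩ := andThreshold_statement c
  refine ⟨r₀, s₀, hr₀, hs₀, fun r s hr hs => ?_⟩
  filter_upwards [hT r s hr hs] with m hm φ hφ
  exact hm φ (threshold_asAnd φ hφ)

/-- CONV gates of width `≤ m^c` with psd dimension `q ≤ 1` are sandwichable: the landed structure
theorem `stub_convLowDimStructure` turns the data into an AND of `≤ (m^c+1)²` real thresholds.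
[folklore] -/
theorem lowDimConv_statement : ∀ c : ℕ, ∃ r₀ s₀ : ℕ, 2 ≤ r₀ ∧ 2 ≤ s₀ ∧ ∀ r s : ℕ,
    r₀ ≤ r → s₀ ≤ s → ∀ᶠ m : ℕ in atTop, ∀ φ : GateFn,
      (∃ p q : ℕ, p + q ≤ m ^ c ∧ q ≤ 1 ∧ ∃ (A : Fin p → Matrix (Fin q) (Fin q) ℝ) (b : Fin p → ℝ)
        (B : Fin p → Fin φ.1 → ℝ), (∀ i j, 0 ≤ B i j) ∧ ∀ v : Fin φ.1 → Bool, φ.2 v = true ↔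
          ∃ Y : Matrix (Fin q) (Fin q) ℝ, Y.PosSemidef ∧
            ∀ i, (A i * Y).trace ≤ b i + ∑ j, B i j * (if v j then (1 : ℝ) else 0)) →
      Sandwichable r s (m ^ (c + 3)) (posFam m) (negFam m) (eps m c) φ := by
  intro c
  obtain ⟨r₀, s₀, hr₀, hs₀, hT⟩ := andThreshold_statement c
  refine ⟨r₀, s₀, hr₀, hs₀, fun r s hr hs => ?_⟩
  filter_upwards [hT r s hr hs] with m hm φ hφ
  exact hm φ (ConvLowDim.stub_convLowDimStructure (m ^ c) φ hφ)

/-- Low-dimensional CONV data make the gate a CONV gate, hence monotone. [folklore] -/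
theorem lowDimConv_monotone {S : ℕ} (φ : GateFn)
    (hφ : ∃ p q : ℕ, p + q ≤ S ∧ q ≤ 1 ∧ ∃ (A : Fin p → Matrix (Fin q) (Fin q) ℝ) (b : Fin p → ℝ)
      (B : Fin p → Fin φ.1 → ℝ), (∀ i j, 0 ≤ B i j) ∧ ∀ v : Fin φ.1 → Bool, φ.2 v = true ↔
        ∃ Y : Matrix (Fin q) (Fin q) ℝ, Y.PosSemidef ∧
          ∀ i, (A i * Y).trace ≤ b i + ∑ j, B i j * (if v j then (1 : ℝ) else 0)) :
    Monotone φ.2 := by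
  obtain ⟨p, q, hpq, -, A, b, B, hB, hrep⟩ := hφ
  exact IsConvGate.monotone (s := S) ⟨p, q, hpq, A, b, B, hB, hrep⟩

/-- PERM gates (any number of points) whose generators generate a group of order `< 2^{L+1}`,
`L = ⌊m^{1/16}⌋₊ (log₂ ⌊m^{1/16}⌋₊ + 1)`, are sandwichable: the landed
`SandwichEffectiveWidth.perm_smallGroup_sandwichable` (its conclusion ignores the pair-count and the
CNF-locality hypotheses). [folklore] -/
theorem smallGroupPerm_statement : ∀ c : ℕ, ∃ r₀ s₀ : ℕ, 2 ≤ r₀ ∧ 2 ≤ s₀ ∧ ∀ r s : ℕ,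
    r₀ ≤ r → s₀ ≤ s → ∀ᶠ m : ℕ in atTop, ∀ φ : GateFn,
      (∃ (d : ℕ) (σ : Fin φ.1 → Equiv.Perm (Fin d)) (τ : Equiv.Perm (Fin d)),
        (∀ v : Fin φ.1 → Bool, φ.2 v = true ↔ τ ∈ Subgroup.closure (σ '' {i | v i = true})) ∧
        Nat.card (Subgroup.closure (Set.range σ)) <
          2 ^ (⌊(m : ℝ) ^ (1 / 16 : ℝ)⌋₊ * (Nat.log 2 ⌊(m : ℝ) ^ (1 / 16 : ℝ)⌋₊ + 1) + 1)) →
      Sandwichable r s (m ^ (c + 3)) (posFam m) (negFam m) (eps m c) φ := by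
  intro c
  obtain ⟨r₀, s₀, hr₀, hs₀, H⟩ := SandwichEffectiveWidth.perm_smallGroup_sandwichable c
  refine ⟨r₀, s₀, hr₀, hs₀, fun r s hr hs => ?_⟩
  filter_upwards [H r s hr hs] with m hm φ hφ
  obtain ⟨d, σ, τ, hφ, hN⟩ := hφ
  intro D C _ hD _ hDC
  exact hm φ d σ τ hφ hN D C hD hDC

/-- GRANK gates (any dimension, any field) with rank threshold `θ ≤ L` are sandwichable: the landed
`SandwichEffectiveWidth.grank_smallThreshold_sandwichable`. [folklore] -/
theorem smallThresholdGRank_statement : ∀ c : ℕ, ∃ r₀ s₀ : ℕ, 2 ≤ r₀ ∧ 2 ≤ s₀ ∧ ∀ r s : ℕ,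
    r₀ ≤ r → s₀ ≤ s → ∀ᶠ m : ℕ in atTop, ∀ φ : GateFn,
      (∃ (F : Type) (_ : Field F) (d θ : ℕ) (K₀ : Matrix (Fin d) (Fin d) F)
        (K : Fin φ.1 → Matrix (Fin d) (Fin d) F),
        (∀ v : Fin φ.1 → Bool, φ.2 v = true ↔ θ ≤ (symbolicMatrix K₀ K v).rank) ∧
        θ ≤ ⌊(m : ℝ) ^ (1 / 16 : ℝ)⌋₊ * (Nat.log 2 ⌊(m : ℝ) ^ (1 / 16 : ℝ)⌋₊ + 1)) →
      Sandwichable r s (m ^ (c + 3)) (posFam m) (negFam m) (eps m c) φ := by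
  intro c
  obtain ⟨r₀, s₀, hr₀, hs₀, H⟩ := SandwichEffectiveWidth.grank_smallThreshold_sandwichable c
  refine ⟨r₀, s₀, hr₀, hs₀, fun r s hr hs => ?_⟩
  filter_upwards [H r s hr hs] with m hm φ hφ
  obtain ⟨F, _, d, θ, K₀, K, hφ, hθ⟩ := hφ
  intro D C _ hD _ hDC
  exact hm φ F d θ K₀ K hφ hθ D C hD hDC

/-! ## §3 The unconditional lower bounds -/

/-- **REAL THRESHOLD GATES OF ANY FAN-IN ARE FREE.** For every `c`, eventually in `m`, no circuit
with `≤ m^c` gates over `{∧₂, ∨₂} ∪ THR_ℝ ∪ PERM_{⌊m^{1/16}⌋₊} ∪ GRANK_{⌊m^{1/16}⌋₊}` — `THR_ℝ` the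
class of all gates `[h ≤ ∑ⱼ βⱼ vⱼ]` with real `β ≥ 0`, `h`, of unbounded fan-in (`⊇ ∧ₖ, ∨ₖ, MAJₖ,
Tₜᵏ`) — computes `CLIQUE(m, ⌈m^{1/4}⌉₊)` (`lowerBound_of_statement` for the union of
`threshold_statement` and `narrowAlgebraic_statement`). [cite: Jukna2012, Thm. 9.17] -/
theorem realThreshold_lowerBound : ∀ c : ℕ, ∀ᶠ m : ℕ in atTop, ∀ C : Circuit ((⊤ : SimpleGraph (Fin m)).edgeSet), C.IsOver (monotoneBasis ∪ {g | ∃ (β : Fin g.1 → ℝ) (h : ℝ), (∀ j, 0 ≤ β j) ∧ ∀ v : Fin g.1 → Bool, g.2 v = true ↔ h ≤ ∑ j, β j * (if v j then (1 : ℝ) else 0)} ∪ {g | IsPermGate ⌊(m : ℝ) ^ (1 / 16 : ℝ)⌋₊ g ∨ IsGRankGate ⌊(m : ℝ) ^ (1 / 16 : ℝ)⌋₊ g}) → C.size ≤ m ^ c → ¬ C.Computes (cliqueFn m ⌈(m : ℝ) ^ (1 / 4 : ℝ)⌉₊) := by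
  intro c
  filter_upwards [lowerBound_of_statement (union_statement threshold_statement
    narrowAlgebraic_statement) (fun c m φ hφ => hφ.elim (threshold_monotone φ) fun h =>
      h.elim IsPermGate.monotone IsGRankGate.monotone) c] with m hm C hC
  refine hm C (hC.mono ?_)
  rintro g ((hg | hg) | hg)
  exacts [Or.inl hg, Or.inr (Or.inl hg), Or.inr (Or.inr hg)]

/-- **CONV GATES OF PSD DIMENSION `≤ 1` ARE FREE.** For every `c`, eventually in `m`, no circuit with
`≤ m^c` gates over `{∧₂, ∨₂} ∪ CONV^{≤1}_{m^c} ∪ PERM_{⌊m^{1/16}⌋₊} ∪ GRANK_{⌊m^{1/16}⌋₊}` —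
`CONV^{≤1}_{m^c}` the SDP-feasibility gates `∃ Y ⪰ 0, tr(Aᵢ Y) ≤ bᵢ + ∑ⱼ Bᵢⱼ[vⱼ]` of width
`p + q ≤ m^c` with `q ≤ 1` — computes `CLIQUE(m, ⌈m^{1/4}⌉₊)`. [cite: Jukna2012, Thm. 9.17] -/
theorem lowDimConv_lowerBound : ∀ c : ℕ, ∀ᶠ m : ℕ in atTop,
    ∀ C : Circuit ((⊤ : SimpleGraph (Fin m)).edgeSet),
      C.IsOver (monotoneBasis ∪ {g | ∃ p q : ℕ, p + q ≤ m ^ c ∧ q ≤ 1 ∧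
          ∃ (A : Fin p → Matrix (Fin q) (Fin q) ℝ) (b : Fin p → ℝ) (B : Fin p → Fin g.1 → ℝ),
            (∀ i j, 0 ≤ B i j) ∧ ∀ v : Fin g.1 → Bool, g.2 v = true ↔
              ∃ Y : Matrix (Fin q) (Fin q) ℝ, Y.PosSemidef ∧
                ∀ i, (A i * Y).trace ≤ b i + ∑ j, B i j * (if v j then (1 : ℝ) else 0)} ∪
        {g | IsPermGate ⌊(m : ℝ) ^ (1 / 16 : ℝ)⌋₊ g ∨ IsGRankGate ⌊(m : ℝ) ^ (1 / 16 : ℝ)⌋₊ g}) →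
      C.size ≤ m ^ c → ¬ C.Computes (cliqueFn m ⌈(m : ℝ) ^ (1 / 4 : ℝ)⌉₊) := by
  intro c
  filter_upwards [lowerBound_of_statement (union_statement lowDimConv_statement
    narrowAlgebraic_statement) (fun c m φ hφ => hφ.elim (lowDimConv_monotone φ) fun h =>
      h.elim IsPermGate.monotone IsGRankGate.monotone) c] with m hm C hC
  refine hm C (hC.mono ?_)
  rintro g ((hg | hg) | hg)
  exacts [Or.inl hg, Or.inr (Or.inl hg), Or.inr (Or.inr hg)]

/-- Every gate of the kitchen-sink class is monotone (thresholds by hand, CONV data via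
`IsConvGate.monotone`, the algebraic classes via `IsPermGate.monotone` / `IsGRankGate.monotone` at
their own dimension). [folklore] -/
theorem kitchenSink_monotone (c m : ℕ) (φ : GateFn)
    (hφ : (∃ (β : Fin φ.1 → ℝ) (h : ℝ), (∀ j, 0 ≤ β j) ∧ ∀ v : Fin φ.1 → Bool,
        φ.2 v = true ↔ h ≤ ∑ j, β j * (if v j then (1 : ℝ) else 0)) ∨
      (∃ p q : ℕ, p + q ≤ m ^ c ∧ q ≤ 1 ∧ ∃ (A : Fin p → Matrix (Fin q) (Fin q) ℝ) (b : Fin p → ℝ)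
        (B : Fin p → Fin φ.1 → ℝ), (∀ i j, 0 ≤ B i j) ∧ ∀ v : Fin φ.1 → Bool, φ.2 v = true ↔
          ∃ Y : Matrix (Fin q) (Fin q) ℝ, Y.PosSemidef ∧
            ∀ i, (A i * Y).trace ≤ b i + ∑ j, B i j * (if v j then (1 : ℝ) else 0)) ∨
      (IsPermGate (TT m) φ ∨ IsGRankGate (TT m) φ) ∨
      (∃ (d : ℕ) (σ : Fin φ.1 → Equiv.Perm (Fin d)) (τ : Equiv.Perm (Fin d)),
        (∀ v : Fin φ.1 → Bool, φ.2 v = true ↔ τ ∈ Subgroup.closure (σ '' {i | v i = true})) ∧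
        Nat.card (Subgroup.closure (Set.range σ)) <
          2 ^ (⌊(m : ℝ) ^ (1 / 16 : ℝ)⌋₊ * (Nat.log 2 ⌊(m : ℝ) ^ (1 / 16 : ℝ)⌋₊ + 1) + 1)) ∨
      (∃ (F : Type) (_ : Field F) (d θ : ℕ) (K₀ : Matrix (Fin d) (Fin d) F)
        (K : Fin φ.1 → Matrix (Fin d) (Fin d) F),
        (∀ v : Fin φ.1 → Bool, φ.2 v = true ↔ θ ≤ (symbolicMatrix K₀ K v).rank) ∧
        θ ≤ ⌊(m : ℝ) ^ (1 / 16 : ℝ)⌋₊ * (Nat.log 2 ⌊(m : ℝ) ^ (1 / 16 : ℝ)⌋₊ + 1))) :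
    Monotone φ.2 := by
  rcases hφ with h | h | h | h | h
  · exact threshold_monotone φ h
  · exact lowDimConv_monotone φ h
  · exact h.elim IsPermGate.monotone IsGRankGate.monotone
  · obtain ⟨d, σ, τ, hφ, -⟩ := h
    exact IsPermGate.monotone ⟨d, le_rfl, σ, τ, hφ⟩
  · obtain ⟨F, hF, d, θ, K₀, K, hφ, -⟩ := h
    exact IsGRankGate.monotone ⟨F, hF, d, θ, le_rfl, K₀, K, hφ⟩

/-- **THE KITCHEN SINK.** For every `c`, eventually in `m`, no circuit with `≤ m^c` gates over
`{∧₂, ∨₂}` together with ALL of: real threshold gates of any fan-in, CONV gates of width `≤ m^c` and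
psd dimension `≤ 1`, PERM/GRANK gates of width `≤ ⌊m^{1/16}⌋₊`, PERM gates (any number of points)
generating a group of order `< 2^{L+1}` and GRANK gates (any dimension and field) with threshold
`≤ L` (`L = ⌊m^{1/16}⌋₊ (log₂ ⌊m^{1/16}⌋₊ + 1)`), computes `CLIQUE(m, ⌈m^{1/4}⌉₊)`.
[cite: Jukna2012, Thm. 9.17] -/
theorem kitchenSink_lowerBound : ∀ c : ℕ, ∀ᶠ m : ℕ in atTop,
    ∀ C : Circuit ((⊤ : SimpleGraph (Fin m)).edgeSet),
      C.IsOver (monotoneBasis ∪ {φ |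
        (∃ (β : Fin φ.1 → ℝ) (h : ℝ), (∀ j, 0 ≤ β j) ∧ ∀ v : Fin φ.1 → Bool,
          φ.2 v = true ↔ h ≤ ∑ j, β j * (if v j then (1 : ℝ) else 0)) ∨
        (∃ p q : ℕ, p + q ≤ m ^ c ∧ q ≤ 1 ∧ ∃ (A : Fin p → Matrix (Fin q) (Fin q) ℝ) (b : Fin p → ℝ)
          (B : Fin p → Fin φ.1 → ℝ), (∀ i j, 0 ≤ B i j) ∧ ∀ v : Fin φ.1 → Bool, φ.2 v = true ↔
            ∃ Y : Matrix (Fin q) (Fin q) ℝ, Y.PosSemidef ∧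
              ∀ i, (A i * Y).trace ≤ b i + ∑ j, B i j * (if v j then (1 : ℝ) else 0)) ∨
        (IsPermGate ⌊(m : ℝ) ^ (1 / 16 : ℝ)⌋₊ φ ∨ IsGRankGate ⌊(m : ℝ) ^ (1 / 16 : ℝ)⌋₊ φ) ∨
        (∃ (d : ℕ) (σ : Fin φ.1 → Equiv.Perm (Fin d)) (τ : Equiv.Perm (Fin d)),
          (∀ v : Fin φ.1 → Bool, φ.2 v = true ↔ τ ∈ Subgroup.closure (σ '' {i | v i = true})) ∧
          Nat.card (Subgroup.closure (Set.range σ)) <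
            2 ^ (⌊(m : ℝ) ^ (1 / 16 : ℝ)⌋₊ * (Nat.log 2 ⌊(m : ℝ) ^ (1 / 16 : ℝ)⌋₊ + 1) + 1)) ∨
        (∃ (F : Type) (_ : Field F) (d θ : ℕ) (K₀ : Matrix (Fin d) (Fin d) F)
          (K : Fin φ.1 → Matrix (Fin d) (Fin d) F),
          (∀ v : Fin φ.1 → Bool, φ.2 v = true ↔ θ ≤ (symbolicMatrix K₀ K v).rank) ∧
          θ ≤ ⌊(m : ℝ) ^ (1 / 16 : ℝ)⌋₊ * (Nat.log 2 ⌊(m : ℝ) ^ (1 / 16 : ℝ)⌋₊ + 1))}) →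
      C.size ≤ m ^ c → ¬ C.Computes (cliqueFn m ⌈(m : ℝ) ^ (1 / 4 : ℝ)⌉₊) :=
  lowerBound_of_statement (union_statement threshold_statement <| union_statement
    lowDimConv_statement <| union_statement narrowAlgebraic_statement <| union_statement
    smallGroupPerm_statement smallThresholdGRank_statement) kitchenSink_monotone

end Summit.PneNP.PneNP.Theorems.CliqueExtLowerBound.WidthThreshold.ThresholdLowerBound

end
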